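import Literature.Geometry.Lorentzian.NearKerrLeafMinkowskiFakeHoles
import Literature.Geometry.Lorentzian.LeafAdaptedModelChartsMinkowski
import Literature.Geometry.Lorentzian.CauchyDevelopmentCausal
import Literature.Geometry.Lorentzian.StationaryOrbitRelation
import HarnessLib

/-!
# Honest near-Kerr leaves: the repaired leaf predicate `CauchyDevelopment.IsHonestNearKerrLeaf`

Route-posited predicate, companion of `CauchyDevelopment.IsNearKerrLeaf` (`NearKerrLeaf.lean`; the
block inlined verbatim in the items `QuietLeaves`/`Capture`/`GenericLegs` of route
`FinalStateConjecture/QuietWindowCapture` and `BondiBartnikRigidity`/`GapExhaustion`/`Capture` of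
route `FinalStateConjecture/BartnikGapSettling`).  Four kernel-checked junk records show that the
typed predicate certifies much less than the items intend:

1. FAKE / PHANTOM HOLES (`NearKerrLeafMinkowskiFakeHoles.lean`; crux dossier `Cruxes/Capture/NOTES.md`
   L2 (I2)): the parameter clause never relates the truncation radius `Rᵢ` to the mass, and at
   `Rᵢ ≤ Mᵢ` the hole slab is EMPTY, so the hole count `N` and the labels `(M, a)` carry no
   information (`Minkowski.isNearKerrLeaf_hyperboloid_fakeHoles`).
2. TOPOLOGICAL OVERLAPS (`Cruxes/Capture/NOTES.md` L8 (B)): the two overlap clauses map a SLAB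
   annulus into the other chart's LAYER image, where no metric control exists, so the certified
   flat annulus and the certified Kerr disc need not meet and transition maps are nowhere
   near-Poincaré.
3. THE DODGE (`NearKerrLeafMinkowskiDodge.lean`, `…Boosted.lean`, `…BoostedDodge.lean`; crux dossier
   `Cruxes/BondiBartnikRigidity/DODGE-c2.md`): the flat chart is certified in UNWEIGHTED Cartesian
   `Cᵏ`, so it may be `(Poincaré) ∘ (id + τ(x̲) ∂₀)` with only `‖∇τ‖_{Cᵏ} ≤ ε/2`; a `0`-hole leaf can
   be a SUPERLUMINAL sheet parked in `J⁺(p)` of any event and in a spatial half-space for all times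
   (`Minkowski.exists_isNearKerrLeaf_subset_causalFuture_forall_dist_lt`), with `J⁻(S) =` everything.
4. NOT ACHRONAL (`Minkowski.exists_isNearKerrLeaf_not_achronal`): a typed leaf may contain two
   chronologically related points.

`IsHonestNearKerrLeaf 𝒟 k ε N M a S` is the typed block VERBATIM plus four clauses, each aimed at one
record: (H₁) THICK HONEST DISCS `2 Mᵢ ≤ Rᵢ` (against 1; the threshold `2M` is the one suggested in
`NearKerrLeafMinkowskiFakeHoles`); (H₂) SLAB-TO-SLAB OVERLAPS — the Kerr annulus
`Ψᵢ{t*ᵢ = 0, ρᵢ < rᵢ ≤ Rᵢ}` lies in the certified flat SLAB `Ψ₀{t₀ = 0}` and the flat annulus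
`Ψ₀{t₀ = 0, ρᵢ < rᵢ < Rᵢ}` lies in the certified Kerr DISC `Ψᵢ{t*ᵢ = 0, rᵢ ≤ Rᵢ}` (against 2; lead c3
of crux `Capture`, `Cruxes/Capture/Lines/Sketch.lean` §7); (H₃) FLAT-FRAME SEPARATION — the
coordinate near-zone tubes `{−1 < t₀ < 1, rᵢ ≤ Rᵢ} ⊆ E4` are pairwise disjoint, so that every flat
annulus lies in the mandatory part of `U₀` (against 2, same source); (H₄) ACHRONALITY of the leaf
`S` (against 3 and 4: an achronal set of Minkowski space is the graph of a `1`-Lipschitz function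
over its spatial projection — O'Neill 1983, Ch. 14, p. 413/425 — and such an entire graph is met by
every timelike straight line, so an honest sheet can neither be superluminal nor dodge an inertial
observer; DODGE-c2 §4 (C1)).  The orientation freedom `Λᵢ ∈ O(1,3)` of the typed block is harmless
(`Cruxes/Capture/NOTES.md` L2 (I4)) and is not repaired.

Proved here: honest ⇒ typed (`IsHonestNearKerrLeaf.isNearKerrLeaf`), honest ⇒ achronal
(`.isAchronal`), monotonicity in `(k, ε)` (`.mono`), and ANTI-VACUITY: the honest unit hyperboloid of
the Minkowski development is achronal (`Minkowski.isAchronal_stretchLeaf_one`) and is an honest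
`(0, k)`-leaf with `0` holes for every `k` (`Minkowski.isHonestNearKerrLeaf_hyperboloid`), so the
repaired predicate is still met by the expected geometry while the four junk records above are
excluded by construction.  Nothing here is asserted about any item; adopting the predicate in the
items is a planner's `route edit`.

## References

* B. O'Neill, *Semi-Riemannian Geometry*, Academic Press 1983, Ch. 14, pp. 402, 413, 425
  (causality of `ℝ⁴₁`; achronal sets; achronal sets as Lipschitz graphs). [ONeillSemiRiemannian1983]
* M. Dafermos, G. Holzegel, I. Rodnianski, M. Taylor, arXiv:2104.08222, §1 (chart / deviation
  vocabulary). [DafermosHolzegelRodnianskiTaylor2021]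
-/

noncomputable section

open Set TopologicalSpace Filter Topology
open scoped Manifold ContDiff Topology ENNReal

universe u

namespace Literature.Geometry.Lorentzian

namespace CauchyDevelopment

variable {X : Type u} [TopologicalSpace X] [ChartedSpace E3 X] [IsManifold (𝓡 3) ∞ X]
  [ConnectedSpace X] {D : InitialDataSet (𝓡 3) X}

/-- **`S` is an HONEST `(ε, k)`-near-Kerr leaf of `𝒟` with `N` holes of masses `M` and spins `a`**:
the block of `CauchyDevelopment.IsNearKerrLeaf` verbatim (same witnesses
`(R, ρ, mo, r, B, U₀, B₀, Ψ, Ψ₀, L, W, L₀, W₀)`, same twenty clauses), followed by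
(H₁) `2 Mᵢ ≤ Rᵢ` (thick honest discs), (H₂) the slab-to-slab overlap clauses
`Ψᵢ '' {t*ᵢ = 0, ρᵢ < rᵢ ≤ Rᵢ} ⊆ Ψ₀ '' {t₀ = 0}` and
`Ψ₀ '' {t₀ = 0, ρᵢ < rᵢ < Rᵢ} ⊆ Ψᵢ '' {t*ᵢ = 0, rᵢ ≤ Rᵢ}`, (H₃) pairwise disjointness of the flat-frame
near-zone tubes `{−1 < t₀ < 1, rᵢ ≤ Rᵢ} ⊆ E4`, and (H₄) achronality of `S`
(`LorentzianMetric.IsAchronal`).  See the module docstring for which junk record each clause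
removes. DHRT arXiv:2104.08222, §1 (chart/deviation vocabulary); O'Neill 1983, Ch. 14, p. 413
(achronal sets). [cite: DafermosHolzegelRodnianskiTaylor2021, §1] -/
def IsHonestNearKerrLeaf (𝒟 : CauchyDevelopment D) (k : ℕ) (ε : ℝ≥0∞) (N : ℕ) (M a : Fin N → ℝ)
    (S : Set 𝒟.carrier) : Prop :=
  ∃ (R ρ : Fin N → ℝ) (mo : Fin N → lorentzGroup × E4) (r : Fin N → E4 → ℝ)
    (B : Fin N → ModelBackground) (U₀ : Opens E4) (B₀ : ModelBackground)
    (Ψ : ∀ i, (B i).domain → 𝒟.carrier) (Ψ₀ : B₀.domain → 𝒟.carrier)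
    (L W : ∀ i, Set (B i).domain) (L₀ W₀ : Set B₀.domain),
    (∀ i, r i = fun x => Kerr.radius (a i) (poincareInv (mo i).1 (mo i).2 x)) ∧
    (∀ i, B i = starBackground (mo i).1 (mo i).2 (M i) (a i) (r i)) ∧
    B₀ = hypBackground U₀ ∧
    (∀ i, L i = {x | -1 < (B i).time x.1 ∧ (B i).time x.1 < 1 ∧ (B i).radius x.1 < R i + 1} ∧
      W i = {x | 0 < (B i).time x.1 ∧ (B i).time x.1 < 1 ∧ (B i).radius x.1 ≤ R i}) ∧
    L₀ = {x | -1 < B₀.time x.1 ∧ B₀.time x.1 < 1} ∧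
    W₀ = {x | 0 < B₀.time x.1 ∧ B₀.time x.1 < 1} ∧
    (∀ i, 0 < M i ∧ |a i| ≤ M i ∧ 0 < ρ i ∧ ρ i < R i) ∧
    {x : E4 | -1 < x 0 - Real.sqrt (1 + E4.spatialNorm x ^ 2) ∧ ∀ i, ρ i < r i x} ⊆
      (U₀ : Set E4) ∧
    (∀ i, ContMDiffOn 𝓘(ℝ, E4) (𝓡 4) ∞ (Ψ i) (L i) ∧ IsOpenEmbedding ((L i).restrict (Ψ i)) ∧
      Ψ i '' L i ⊆ 𝒟.metric.causalFuture 𝒟.timeOrientation (range 𝒟.embed)) ∧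
    ContMDiffOn 𝓘(ℝ, E4) (𝓡 4) ∞ Ψ₀ L₀ ∧ IsOpenEmbedding (L₀.restrict Ψ₀) ∧
    Ψ₀ '' L₀ ⊆ 𝒟.metric.causalFuture 𝒟.timeOrientation (range 𝒟.embed) ∧
    (∀ i, 𝒟.toSpacetime.truncDeviationCk (B i) (Ψ i) k (R i) 0 ≤ ε) ∧
    𝒟.toSpacetime.deviationCk B₀ Ψ₀ k 0 ≤ ε ∧
    Pairwise (Function.onFun Disjoint fun i => Ψ i '' {x | x ∈ L i ∧ (B i).radius x.1 ≤ R i}) ∧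
    (∀ i, Ψ i '' {x | (B i).time x.1 = 0 ∧ ρ i < (B i).radius x.1 ∧ (B i).radius x.1 ≤ R i} ⊆
      Ψ₀ '' L₀) ∧
    (∀ i, Ψ₀ '' {x | B₀.time x.1 = 0 ∧ ρ i < r i x.1 ∧ r i x.1 < R i} ⊆ Ψ i '' L i) ∧
    S = Ψ₀ '' B₀.timeSlab 0 ∪ ⋃ i, Ψ i '' (B i).truncTimeSlab (R i) 0 ∧
    Ψ₀ '' W₀ ∪ ⋃ i, Ψ i '' W i ⊆ 𝒟.metric.chronologicalFuture 𝒟.timeOrientation S ∧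
    𝒟.exteriorOf (Ψ₀ '' W₀ ∪ ⋃ i, Ψ i '' W i) \ (Ψ₀ '' W₀ ∪ ⋃ i, Ψ i '' W i) ⊆
      𝒟.metric.causalPast 𝒟.timeOrientation S ∧
    -- (H₁) thick honest discs: no fake / phantom labels
    (∀ i, 2 * M i ≤ R i) ∧
    -- (H₂) slab-to-slab overlaps, hole side: the Kerr annulus is charted by the certified flat SLAB
    (∀ i, Ψ i '' {x | (B i).time x.1 = 0 ∧ ρ i < (B i).radius x.1 ∧ (B i).radius x.1 ≤ R i} ⊆
      Ψ₀ '' B₀.timeSlab 0) ∧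
    -- (H₂) slab-to-slab overlaps, flat side: the flat annulus is charted by the certified Kerr DISC
    (∀ i, Ψ₀ '' {x | B₀.time x.1 = 0 ∧ ρ i < r i x.1 ∧ r i x.1 < R i} ⊆
      Ψ i '' (B i).truncTimeSlab (R i) 0) ∧
    -- (H₃) flat-frame separation of the coordinate near-zone tubes on the hyperboloidal layer
    Pairwise (Function.onFun Disjoint fun i =>
      {x : E4 | -1 < x 0 - Real.sqrt (1 + E4.spatialNorm x ^ 2) ∧
        x 0 - Real.sqrt (1 + E4.spatialNorm x ^ 2) < 1 ∧ r i x ≤ R i}) ∧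
    -- (H₄) the leaf is achronal
    𝒟.metric.IsAchronal 𝒟.timeOrientation S

namespace IsHonestNearKerrLeaf

variable {𝒟 : CauchyDevelopment D} {k k' : ℕ} {ε ε' : ℝ≥0∞} {N : ℕ} {M a : Fin N → ℝ}
  {S : Set 𝒟.carrier}

/-- Honest leaves are typed leaves (projection onto the block of `IsNearKerrLeaf`, same charts).
[cite: DafermosHolzegelRodnianskiTaylor2021, §1] -/
theorem isNearKerrLeaf (h : 𝒟.IsHonestNearKerrLeaf k ε N M a S) : 𝒟.IsNearKerrLeaf k ε N M a S := by
  obtain ⟨R, ρ, mo, r, B, U₀, B₀, Ψ, Ψ₀, L, W, L₀, W₀, h1, h2, h3, h4, h5, h6, h7, h8, h9, h10, h11,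
    h12, h13, h14, h15, h16, h17, h18, h19, h20, -⟩ := h
  exact ⟨R, ρ, mo, r, B, U₀, B₀, Ψ, Ψ₀, L, W, L₀, W₀, h1, h2, h3, h4, h5, h6, h7, h8, h9, h10, h11,
    h12, h13, h14, h15, h16, h17, h18, h19, h20⟩

/-- Honest leaves are achronal (clause (H₄)). O'Neill 1983, Ch. 14, p. 413.
[cite: ONeillSemiRiemannian1983, Ch. 14, p. 413] -/
theorem isAchronal (h : 𝒟.IsHonestNearKerrLeaf k ε N M a S) :
    𝒟.metric.IsAchronal 𝒟.timeOrientation S := by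
  obtain ⟨_, _, _, _, _, _, _, _, _, _, _, _, _, -, -, -, -, -, -, -, -, -, -, -, -, -, -, -, -, -,
    -, -, -, -, -, -, -, hach⟩ := h
  exact hach

/-- The holes of an honest leaf have positive masses, `|aᵢ| ≤ Mᵢ`, and THICK discs: some truncation
radius `Rᵢ ≥ 2 Mᵢ` is certified (clauses (7) and (H₁)). [cite: DafermosHolzegelRodnianskiTaylor2021, §1] -/
theorem mass_pos_and_abs_spin_le (h : 𝒟.IsHonestNearKerrLeaf k ε N M a S) (i : Fin N) :
    0 < M i ∧ |a i| ≤ M i := by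
  obtain ⟨_, _, _, _, _, _, _, _, _, _, _, _, _, -, -, -, -, -, -, hpar, -⟩ := h
  exact ⟨(hpar i).1, (hpar i).2.1⟩

/-- **Monotonicity in `(k, ε)`**: an honest `(ε, k')`-leaf is an honest `(ε', k)`-leaf for `k ≤ k'`,
`ε ≤ ε'`, with the same charts (`supCkENorm_mono_right`). [cite: DafermosHolzegelRodnianskiTaylor2021, §1] -/
theorem mono (h : 𝒟.IsHonestNearKerrLeaf k' ε N M a S) (hk : k ≤ k') (hε : ε ≤ ε') :
    𝒟.IsHonestNearKerrLeaf k ε' N M a S := by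
  obtain ⟨R, ρ, mo, r, B, U₀, B₀, Ψ, Ψ₀, L, W, L₀, W₀, hr, hB, hB₀, hLW, hL₀, hW₀, hpar, hU₀, hΨ,
    hΨ₀, hΨ₀e, hΨ₀J, hdev, hdev₀, hrest⟩ := h
  exact ⟨R, ρ, mo, r, B, U₀, B₀, Ψ, Ψ₀, L, W, L₀, W₀, hr, hB, hB₀, hLW, hL₀, hW₀, hpar, hU₀, hΨ,
    hΨ₀, hΨ₀e, hΨ₀J, fun i ↦ ((supCkENorm_mono_right _ hk _).trans (hdev i)).trans hε,
    ((supCkENorm_mono_right _ hk _).trans hdev₀).trans hε, hrest⟩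

end IsHonestNearKerrLeaf

end CauchyDevelopment

/-! ### Anti-vacuity: the honest unit hyperboloid of the Minkowski development -/

namespace Minkowski

/-- `√(1 + ·²)` is `1`-Lipschitz: `|√(1+s²) − √(1+t²)| ≤ |s − t|`. [folklore] -/
theorem abs_sqrt_one_add_sq_sub_le (s t : ℝ) : |√(1 + s ^ 2) - √(1 + t ^ 2)| ≤ |s - t| := by
  have hs : 0 < √(1 + s ^ 2) := Real.sqrt_pos.2 (by positivity)
  have ht : 0 < √(1 + t ^ 2) := Real.sqrt_pos.2 (by positivity)
  have hss : √(1 + s ^ 2) ^ 2 = 1 + s ^ 2 := Real.sq_sqrt (by positivity)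
  have htt : √(1 + t ^ 2) ^ 2 = 1 + t ^ 2 := Real.sq_sqrt (by positivity)
  have hs' : |s| ≤ √(1 + s ^ 2) := abs_le_sqrt_one_add_sq s
  have ht' : |t| ≤ √(1 + t ^ 2) := abs_le_sqrt_one_add_sq t
  -- (√(1+s²) − √(1+t²)) (√(1+s²) + √(1+t²)) = (s − t)(s + t), and |s + t| ≤ √(1+s²) + √(1+t²)
  have hsum : |s + t| ≤ √(1 + s ^ 2) + √(1 + t ^ 2) := (abs_add_le s t).trans (add_le_add hs' ht')
  rw [abs_le]
  constructor
  · nlinarith [abs_nonneg (s - t), abs_mul_abs_self (s - t), sq_abs (s + t), abs_nonneg (s + t),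
      mul_le_mul_of_nonneg_left hsum (abs_nonneg (s - t)), abs_sub_abs_le_abs_sub s t,
      neg_abs_le (s - t), le_abs_self (s - t), neg_abs_le (s + t), le_abs_self (s + t)]
  · nlinarith [abs_nonneg (s - t), abs_mul_abs_self (s - t), sq_abs (s + t), abs_nonneg (s + t),
      mul_le_mul_of_nonneg_left hsum (abs_nonneg (s - t)), abs_sub_abs_le_abs_sub s t,
      neg_abs_le (s - t), le_abs_self (s - t), neg_abs_le (s + t), le_abs_self (s + t)]

/-- Points of the honest unit hyperboloid `stretchLeaf 1` satisfy `x⁰ = √(1 + ‖x̲‖²)`. [folklore] -/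
theorem apply_zero_of_mem_stretchLeaf_one {x : E4} (hx : x ∈ stretchLeaf 1) :
    x 0 = √(1 + ‖E4.spatial x‖ ^ 2) := by
  obtain ⟨y, hy, rfl⟩ := hx
  rw [stretchChart_apply, timeStretch_one]
  rw [ModelBackground.mem_timeSlab, hypTime_eq] at hy
  linarith

/-- **The honest unit hyperboloid of Minkowski space is achronal**: for `q, q'` on
`{x⁰ = √(1+‖x̲‖²)}`, `q' ∈ I⁺(q) ⊆ J⁺(q)` would give `‖q̲' − q̲‖ ≤ q'⁰ − q⁰ ≤ |‖q̲'‖ − ‖q̲‖| ≤ ‖q̲' − q̲‖`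
by the `1`-Lipschitz bound, whence (squaring the defining relation) `q = q'`, contradicting
chronology of the development (`CauchyDevelopment.isChronological`). O'Neill 1983, Ch. 14, p. 413
(achronal sets), p. 402 (`J⁺` in `ℝ⁴₁`). [cite: ONeillSemiRiemannian1983, Ch. 14, p. 413] -/
theorem isAchronal_stretchLeaf_one :
    vacuumCauchyDevelopment.metric.IsAchronal vacuumCauchyDevelopment.timeOrientation
      (stretchLeaf 1) := by
  intro (q : E4) hq (q' : E4) hq' hI
  have hq0 := apply_zero_of_mem_stretchLeaf_one hq
  have hq'0 := apply_zero_of_mem_stretchLeaf_one hq'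
  -- chronological ⇒ causal ⇒ inside the closed cone
  have hJ : q' ∈ vacuumCauchyDevelopment.metric.causalFuture vacuumCauchyDevelopment.timeOrientation
      ({q} : Set E4) :=
    LorentzianMetric.chronologicalFuture_subset_causalFuture vacuumCauchyDevelopment.metric
      vacuumCauchyDevelopment.timeOrientation _ hI
  have hcone : ‖E4.spatial q' - E4.spatial q‖ ≤ q' 0 - q 0 := by
    have := (Set.ext_iff.mp (Minkowski.causalFuture_singleton q) q').mp hJ
    exact this
  -- the hyperboloid is a 1-Lipschitz graph
  have hlip : q' 0 - q 0 ≤ |‖E4.spatial q'‖ - ‖E4.spatial q‖| := by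
    rw [hq0, hq'0]
    exact (le_abs_self _).trans (abs_sqrt_one_add_sq_sub_le _ _)
  have hrev : |‖E4.spatial q'‖ - ‖E4.spatial q‖| ≤ ‖E4.spatial q' - E4.spatial q‖ :=
    abs_norm_sub_norm_le _ _
  -- hence all three are equal; squaring x⁰ = √(1+‖x̲‖²) then forces q = q'
  have hd : q' 0 - q 0 = ‖E4.spatial q' - E4.spatial q‖ := le_antisymm (hlip.trans hrev) hcone
  set s := ‖E4.spatial q‖ with hs
  set s' := ‖E4.spatial q'‖ with hs'
  have hss : √(1 + s ^ 2) ^ 2 = 1 + s ^ 2 := Real.sq_sqrt (by positivity)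
  have hss' : √(1 + s' ^ 2) ^ 2 = 1 + s' ^ 2 := Real.sq_sqrt (by positivity)
  have h1 : 0 < √(1 + s ^ 2) := Real.sqrt_pos.2 (by positivity)
  have h1' : 0 < √(1 + s' ^ 2) := Real.sqrt_pos.2 (by positivity)
  have habs : |s' - s| ≤ ‖E4.spatial q' - E4.spatial q‖ := abs_norm_sub_norm_le _ _
  have heq : ‖E4.spatial q' - E4.spatial q‖ = |s' - s| := by
    refine le_antisymm ?_ habs
    rw [← hd, hq0, hq'0]
    exact (le_abs_self _).trans (abs_sqrt_one_add_sq_sub_le _ _)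
  -- from √(1+s'²) − √(1+s²) = |s' − s| we get s = s'
  have hsq : √(1 + s' ^ 2) - √(1 + s ^ 2) = |s' - s| := by rw [← hq0, ← hq'0, hd, heq]
  have hss_eq : s' = s := by
    by_contra hne
    have hpos : 0 < |s' - s| := abs_pos.2 (sub_ne_zero.2 hne)
    have hs0 : 0 ≤ s := norm_nonneg _
    have hs0' : 0 ≤ s' := norm_nonneg _
    -- (√(1+s'²) − √(1+s²))(√(1+s'²) + √(1+s²)) = s'² − s² = (s'−s)(s'+s), but √+√ > s'+s ≥ |s'+s|… strict
    have hstrict : |s' + s| < √(1 + s' ^ 2) + √(1 + s ^ 2) := by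
      rw [abs_of_nonneg (by linarith)]
      have : s' < √(1 + s' ^ 2) := (Real.lt_sqrt hs0').2 (by nlinarith)
      have : s ≤ √(1 + s ^ 2) := (Real.le_sqrt hs0 (by positivity)).2 (by nlinarith)
      linarith
    have hprod : (√(1 + s' ^ 2) - √(1 + s ^ 2)) * (√(1 + s' ^ 2) + √(1 + s ^ 2)) =
        (s' - s) * (s' + s) := by nlinarith
    rw [hsq] at hprod
    have : |s' - s| * (√(1 + s' ^ 2) + √(1 + s ^ 2)) > |s' - s| * |s' + s| :=
      mul_lt_mul_of_pos_left hstrict hpos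
    have h2 : |s' - s| * |s' + s| = |(s' - s) * (s' + s)| := (abs_mul _ _).symm
    rw [h2, ← hprod] at this
    exact lt_irrefl _ (this.trans_le (le_abs_self _))
  have hsp : E4.spatial q' = E4.spatial q := by
    have : ‖E4.spatial q' - E4.spatial q‖ = 0 := by rw [heq, hss_eq, sub_self, abs_zero]
    exact sub_eq_zero.1 (norm_eq_zero.1 this)
  have ht : q' 0 = q 0 := by rw [hq0, hq'0, hss_eq]
  have htime : E4.time q' = E4.time q := ht
  have hqq : q' = q := by
    rw [← E4.ofTimeSpace_time_spatial q', ← E4.ofTimeSpace_time_spatial q, htime, hsp]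
  subst hqq
  exact (vacuumCauchyDevelopment.toCauchyDevelopment.isChronological).not_mem_chronologicalFuture_self
    q' hI

/-- **ANTI-VACUITY of the repaired predicate**: the honest unit hyperboloid of the Minkowski
development is an HONEST `(0, k)`-near-Kerr leaf with `0` holes, for every `k` (the typed block from
`isNearKerrLeaf_hyperboloid_fakeHoles` at `N = 0` — identity flat chart, zero deviation, honest barrier
clause; (H₁)–(H₃) quantify over `Fin 0`; (H₄) is `isAchronal_stretchLeaf_one`).
[cite: ONeillSemiRiemannian1983, Ch. 14, p. 413] -/
theorem isHonestNearKerrLeaf_hyperboloid (k : ℕ) :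
    vacuumCauchyDevelopment.toCauchyDevelopment.IsHonestNearKerrLeaf k 0 0 ![] ![] (stretchLeaf 1) := by
  obtain ⟨R, ρ, mo, r, B, U₀, B₀, Ψ, Ψ₀, L, W, L₀, W₀, h1, h2, h3, h4, h5, h6, h7, h8, h9, h10, h11,
    h12, h13, h14, h15, h16, h17, h18, h19, h20⟩ :=
    isNearKerrLeaf_hyperboloid_fakeHoles k 0 ![] (fun i => i.elim0)
  exact ⟨R, ρ, mo, r, B, U₀, B₀, Ψ, Ψ₀, L, W, L₀, W₀, fun i => i.elim0, fun i => i.elim0, h3, h4, h5,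
    h6, fun i => i.elim0, h8, h9, h10, h11, h12, h13, h14, h15, h16, h17, h18, h19, h20,
    fun i => i.elim0, fun i => i.elim0, fun i => i.elim0, fun i => i.elim0,
    isAchronal_stretchLeaf_one⟩

/-- Hence honest leaves exist: for every `k` and every `ε` the Minkowski development has an honest
`(ε, k)`-near-Kerr leaf with `0` holes (monotonicity in `ε`). [cite: ONeillSemiRiemannian1983, Ch. 14, p. 413] -/
theorem exists_isHonestNearKerrLeaf (k : ℕ) (ε : ℝ≥0∞) :
    ∃ S : Set E4, vacuumCauchyDevelopment.toCauchyDevelopment.IsHonestNearKerrLeaf k ε 0 ![] ![] S :=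
  ⟨_, (isHonestNearKerrLeaf_hyperboloid k).mono le_rfl bot_le⟩

end Minkowski

end Literature.Geometry.Lorentzian

end
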